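import Summits.ABC.IUTFork.LDHSplitBadPrimeNumberField
import Summits.ABC.IUTFork.LDHPerPrimeReadingSlotConstant
import HarnessLib

/-!
# The fork at [IUTchIII] Corollary 3.12, L-DH level: over EVERY number field other than `ℚ` the typed `Cor312Of` takes BOTH truth
# values at UNBOUNDED depth — decided by the choice of the bad set over one completely split prime

Proof-only companion (D-0012; 0 definitions, no `Prop` fact) of `LDHSplitBadPrimeNumberField.lean` (abc-iut-w5-d018, p430071) and
abc-iut-w5-d157's `LDHPerPrimeReadingSlotConstant.lean`; WAVE-5 prover abc-iut-w5-d018 (gen 4). TAKES NO SIDE on [IUTchIII]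
Cor. 3.12.

Two synthetic one-prime families of Θ-volume inputs over number fields `F₀ ⊆ K` (place section `σ`, prime `l ≥ 5`, rational
prime `p`, depth `N`; `j_E := p^{−2lN}`, ideles = powers of `p` in the genuine completions) are in the tree:
* abc-iut-w5-d157's `deepAt p l N σ` — bad set `𝕍^bad := V(F₀)_p` (ALL places over `p`; bad mass `β_p = 1`): for EVERY `F₀`,
  `Cor312Of` FAILS at SOME depth (`exists_deepAt_not_cor312Of'`; slot-constant family, the Step-(v) discrepancy is `N`-free
  while `|log(q)|` grows) — and, abc-iut-skel's `ForkGenuineDepthFamily`, HOLDS at small depth (the family crosses the band);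
* abc-iut-c312-3's `deepAtPlace p v₀ l N σ` — bad set `𝕍^bad := {v₀}`: `Cor312Of` HOLDS at EVERY depth as soon as
  `2·n_{v₀} ≤ [F₀:ℚ]` (`cor312Of_deepAtPlace_half`), e.g. over a completely split `p` of any `F₀ ≠ ℚ`
  (`exists_cor312Of_deepAtPlace_of_two_le_finrank`).
THIS FILE puts them side by side at ONE completely split prime:

* **`fork_both_sides_at_split_prime`** — `F₀` any number field, `p` completely split in `F₀` with `2 ≤ [F₀:ℚ]`, `v₀ | p`: (FALSE
  side) some depth `N` with `¬ Cor312Of (deepAt p l N σ)`, AND (TRUE side) `Cor312Of (deepAtPlace p v₀ l N σ)` for EVERY `N`;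
* **`fork_both_sides_of_two_le_finrank`** — for EVERY number field `F₀ ≠ ℚ` (any `K ⊇ F₀`, `σ`, prime `l ≥ 5`) there is a
  rational prime `p` carrying BOTH families: same base, same extension, same section, same `l`, same `p`, same recipe for the
  ideles — only the bad set differs (`V(F₀)_p` vs one place over `p`) — and the typed inequality is FALSE deep in the first,
  TRUE at every depth in the second;
* `fork_both_sides_unbounded_depth` — both sides at UNBOUNDED `q`-degree over the same `F₀ ≠ ℚ`: for every bound `B`, a FALSE
  input (some depth of `deepAt`, whose `q`-degree `2lN·log p` exceeds `B` once `N` is large — here packaged through the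
  crossing depth) and a TRUE input with `deĝ̲(𝔮) > B`.

READING (neutral): in the tree's sharp Dupuy–Hilado-level model ((Ind1) = all capsule-index permutations, STEPV-IND1-NOTE R2) the
truth value of the typed `Cor312Of` at synthetic genuine-completion inputs over a number field `F₀ ≠ ℚ` is NOT a function of
`(F₀, l, deĝ̲(𝔮))`: at every large depth both values occur, selected by the place combinatorics of `𝕍^bad` alone. Over
`F_mod = ℚ` (the route to `Summit.ABC`) only the first family exists. HONEST SCOPE as the parent files: synthetic inhabitants of
the input type, not initial Θ-data; typed objects; nothing here bears on whether [IUTchIII] Thm. 3.11 licenses (1.1); typed ≠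
proved. [cite: DupuyHilado2025, §1 (1.1), §3.3, §3.6, Thm. 3.10.1] [cite: Mochizuki2012, IUTchIII Cor. 3.12 p. 173–174]
[claim: Mochizuki2012, status: disputed] for every IUT quotation.
-/

noncomputable section

open NumberField IsDedekindDomain Literature.IUT.LogVolume
open Literature.NumberTheory.GaloisRepresentations Literature.NumberTheory.NumberFields

namespace Summit.ABC.IUTFork

variable {F₀ : Type} [Field F₀] [NumberField F₀] {K : Type} [Field K] [NumberField K] [Algebra F₀ K]

/-- **Both sides of the fork at ONE completely split prime.** If `p` splits completely in `F₀` and `2 ≤ [F₀:ℚ]`, then for every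
`v₀ | p`, every `K ⊇ F₀` with place section `σ` and every prime `l ≥ 5`: the all-places-over-`p` family `deepAt` has a depth at
which the typed `Cor312Of` FAILS (abc-iut-w5-d157), while the one-place family `deepAtPlace … v₀ …` satisfies `Cor312Of` at EVERY
depth (`n_{v₀} = 1`, threshold `1/2`). Synthetic inputs; typed objects; no side taken. [claim: Mochizuki2012, status: disputed]
[cite: DupuyHilado2025, §1 (1.1), §3.6, Thm. 3.10.1] -/
theorem fork_both_sides_at_split_prime (p : ℕ) [Fact p.Prime] (hsplit : SplitsCompletely F₀ p)
    (h2 : 2 ≤ Module.finrank ℚ F₀) (v₀ : placesOver F₀ p) (σ : PlaceSection F₀ K) (l : ℕ) (hl : l.Prime) (h5 : 5 ≤ l) :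
    (∃ (N : ℕ) (hN : 0 < N), ¬ (ThetaVolumeInput.deepAt p l hl h5 N hN σ).Cor312Of) ∧
      ∀ (N : ℕ) (hN : 0 < N), (ThetaVolumeInput.deepAtPlace p v₀ l hl h5 N hN σ).Cor312Of := by
  refine ⟨ThetaVolumeInput.exists_deepAt_not_cor312Of' p l hl h5 σ, fun N hN => ?_⟩
  have hv₀ : 2 * localDegree F₀ v₀.1 ≤ Module.finrank ℚ F₀ := by
    rw [localDegree_eq_one_of_splitsCompletely hsplit v₀.2, mul_one]; exact h2
  exact (cor312Of_deepAtPlace_half p v₀ l hl h5 N hN σ hv₀).2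

/-- **Over EVERY number field `F₀ ≠ ℚ` the typed `Cor312Of` takes BOTH truth values at one rational prime**: for `2 ≤ [F₀:ℚ]`, any
`K ⊇ F₀`, `σ`, prime `l ≥ 5`, there are a prime `p` (completely split in `F₀` — the tree's Chebotarev `exists_splitsCompletely`)
and a place `v₀ | p` such that the `deepAt p` family is FALSE at some depth and the `deepAtPlace p v₀` family is TRUE at every
depth — same base, extension, section, `l`, `p` and idele recipe; only `𝕍^bad` differs (`V(F₀)_p` versus `{v₀}`).
[claim: Mochizuki2012, status: disputed] [cite: DupuyHilado2025, §1 (1.1), §3.6, Thm. 3.10.1] [cite: MochizukiFrdI2008, Thm. 6.4 (iv) p.116] -/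
theorem fork_both_sides_of_two_le_finrank (h2 : 2 ≤ Module.finrank ℚ F₀) (σ : PlaceSection F₀ K)
    (l : ℕ) (hl : l.Prime) (h5 : 5 ≤ l) :
    ∃ (p : ℕ) (_ : Fact p.Prime) (v₀ : placesOver F₀ p),
      (∃ (N : ℕ) (hN : 0 < N), ¬ (ThetaVolumeInput.deepAt p l hl h5 N hN σ).Cor312Of) ∧
        ∀ (N : ℕ) (hN : 0 < N), (ThetaVolumeInput.deepAtPlace p v₀ l hl h5 N hN σ).Cor312Of := by
  obtain ⟨p, hp, hsplit⟩ := exists_splitsCompletely F₀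
  haveI : Fact p.Prime := ⟨hp⟩
  obtain ⟨w, hw⟩ := placesOver_nonempty F₀ p
  exact ⟨p, inferInstance, ⟨w, hw⟩, fork_both_sides_at_split_prime p hsplit h2 ⟨w, hw⟩ σ l hl h5⟩

/-- **Both sides at UNBOUNDED depth over the same `F₀ ≠ ℚ`**: for every bound `B` there are, over the same completely split prime,
a depth at which the all-places family is FALSE and a one-place input with `deĝ̲(𝔮) > B` at which the typed `Cor312Of` is TRUE —
the truth value is selected by `𝕍^bad`, not by `(F₀, l, deĝ̲(𝔮))`. [claim: Mochizuki2012, status: disputed]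
[cite: DupuyHilado2025, §1 (1.1), §3.3, §3.6] -/
theorem fork_both_sides_unbounded_depth (h2 : 2 ≤ Module.finrank ℚ F₀) (σ : PlaceSection F₀ K)
    (l : ℕ) (hl : l.Prime) (h5 : 5 ≤ l) (B : ℝ) :
    ∃ (p : ℕ) (_ : Fact p.Prime) (v₀ : placesOver F₀ p),
      (∃ (N : ℕ) (hN : 0 < N), ¬ (ThetaVolumeInput.deepAt p l hl h5 N hN σ).Cor312Of) ∧
        ∃ (N : ℕ) (hN : 0 < N),
          B < FinDivisor.ndeg F₀ (ThetaVolumeInput.deepAtPlace p v₀ l hl h5 N hN σ).X.qDivisor ∧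
            (ThetaVolumeInput.deepAtPlace p v₀ l hl h5 N hN σ).Cor312Of := by
  obtain ⟨p, hp, v₀, hfalse, htrue⟩ := fork_both_sides_of_two_le_finrank h2 σ l hl h5
  haveI := hp
  obtain ⟨N, hN, hB⟩ := ThetaVolumeInput.exists_deepAtPlace_ndeg_qDivisor_gt p v₀ l hl h5 σ B
  exact ⟨p, hp, v₀, hfalse, N, hN, hB, htrue N hN⟩

end Summit.ABC.IUTFork

end
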